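import Mathlib
import Literature.Computability.AlgebraicComplexity.NewtonPolygonTauProductBounds
import Summits.ValiantsHypothesis.ValiantsHypothesis.Theorems.NewtonUnitEquationsDissociatedUniformTotalsLaw
import HarnessLib

/-!
# Crux `NewtonUnitEquations.DissociatedUniform` (stmt-ValiantsHypothesis-5905): the `n = 3` totals law — STRUCTURED PARTNER SETS
# FORCE SUB-ALPHABET TOPS (the coupling that the abstract `q^{5/2}` adversary violates)

Memo `Cruxes/DissociatedUniform/NOTES-t1g17.md` §3.  At a weight `w` write `β = ⟨w, b ·⟩`, `γ = ⟨w, c ·⟩`.  The pair `(y, z)` is the top of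
its `Q`-fibre `Q_{y+z} = {b y' + c z' : y' + z' = y + z}` iff `β y' + γ z' < β y + γ z` for all other pairs of the fibre; the
PARTNER SET of the letter `y` is `N_Q(y) = {z : (y, z) tops Q_{y+z}}` (its size is the degree `deg_Q y` of `…TotalsLawHeavyPairs`).
The exponent-`5/2` bound of `…TotalsLawSubCubic` treats the three realised top systems as ABSTRACT interval systems, and
`…TotalsLawHeavyPairsSharp` shows that abstract model is sharp at `q^{5/2}`: over `G = ℤ_k × ℤ_k` its heavy letters have partner sets
equal to COSETS `Z_{k₁} = (0, k₁) + (ℤ_k × 0)` and every letter re-acquires such a partner set `k = √q` times per rotation.  This file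
records, in kernel, why REALISED systems cannot do that:
* `card_mul_sub_le_of_partners` — comparing `(y, z)` with the competitor `(y + δ, z − δ)` for every partner `z ∈ N` and summing:
  `#N · (β(y+δ) − β y) ≤ Σ_{z∈N} γ z − Σ_{z∈N} γ(z − δ)`;
* `sum_sub_shift_eq_zero` — if `N` is `δ`-invariant (`z ∈ N ⇒ z − δ ∈ N`; e.g. a coset of a subgroup containing `δ`,
  `coset_shift_mem`) the right side VANISHES, so **`lt_of_invariant_partners`: `β(y + δ) < β y`** — a letter whose partner set contains
  a `δ`-invariant set beats `y + δ`; with a coset `z₀ + H` of partners, `y` is the STRICT TOP of the sub-alphabet `{b(y + h) : h ∈ H}`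
  (`isStrictTop_subalphabet_of_coset_partners`), and strict tops of a FIXED finite set along a half-chart occupy ONE interval of times
  (`IsStrictTop.of_between`): coset-structured heaviness cannot recur, which is exactly the re-bursting the abstract adversary needs;
* the quantitative form for NEARLY invariant partner sets: `sum_sub_shift_le` —
  `Σ_{z∈N} γ z − Σ_{z∈N} γ(z−δ) ≤ #(N ∖ (N − δ)) · (M − m)` when `m ≤ γ ≤ M`, hence
  `card_mul_sub_le_card_sdiff_mul`: `#N · (β(y+δ) − β y) ≤ #(N ∖ (N−δ)) · osc γ`.
Honest label: elementary exchange/averaging identities (pure bookkeeping over the group, companions of `…TotalsLaw.le_of_wins_all` and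
`…TotalsLawEdgeExchange`); they locate the missing COUPLING input for exponent `2` but prove no new bound; `TotalsLawThree C`,
`TriWordsBound C` remain OPEN and are asserted nowhere; nothing here bears on VP ≠ VNP.
[folklore]
-/

set_option linter.dupNamespace false -- `ValiantsHypothesis.ValiantsHypothesis` (summit = problem) in every name

open Matrix Finset
open scoped BigOperators Pointwise

namespace Summit.ValiantsHypothesis.ValiantsHypothesis.Theorems.NewtonUnitEquationsDissociatedUniform

namespace TotalsLaw

open Literature.Computability.AlgebraicComplexity.KPTT.PlanarMinkowski

variable {G : Type*} [AddCommGroup G]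

/-- **Summed exchange inequality.**  If for every partner `z ∈ N` the pair `(y, z)` (weakly) beats the competitor `(y + δ, z − δ)` of
the same `Q`-fibre, then `#N · (β(y+δ) − β y) ≤ Σ_{z∈N} γ z − Σ_{z∈N} γ(z − δ)`. [folklore] -/
theorem card_mul_sub_le_of_partners (β γ : G → ℝ) (y δ : G) (N : Finset G)
    (h : ∀ z ∈ N, β (y + δ) + γ (z - δ) ≤ β y + γ z) :
    (N.card : ℝ) * (β (y + δ) - β y) ≤ ∑ z ∈ N, γ z - ∑ z ∈ N, γ (z - δ) := by
  have hs : ∑ z ∈ N, (β (y + δ) + γ (z - δ)) ≤ ∑ z ∈ N, (β y + γ z) := Finset.sum_le_sum h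
  rw [Finset.sum_add_distrib, Finset.sum_add_distrib, Finset.sum_const, Finset.sum_const, nsmul_eq_mul, nsmul_eq_mul] at hs
  linarith

/-- Strict version: with a nonempty partner set and strict wins, `#N · (β(y+δ) − β y) < Σ_{z∈N} γ z − Σ_{z∈N} γ(z − δ)`. [folklore] -/
theorem card_mul_sub_lt_of_partners (β γ : G → ℝ) (y δ : G) (N : Finset G) (hne : N.Nonempty)
    (h : ∀ z ∈ N, β (y + δ) + γ (z - δ) < β y + γ z) :
    (N.card : ℝ) * (β (y + δ) - β y) < ∑ z ∈ N, γ z - ∑ z ∈ N, γ (z - δ) := by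
  have hs : ∑ z ∈ N, (β (y + δ) + γ (z - δ)) < ∑ z ∈ N, (β y + γ z) := Finset.sum_lt_sum_of_nonempty hne h
  rw [Finset.sum_add_distrib, Finset.sum_add_distrib, Finset.sum_const, Finset.sum_const, nsmul_eq_mul, nsmul_eq_mul] at hs
  linarith

/-- **Shift-invariant partner sets cancel the third curve**: if `z ∈ N ⇒ z − δ ∈ N` then `Σ_{z∈N} γ(z − δ) = Σ_{z∈N} γ z`
(translation by `δ` permutes `N`). [folklore] -/
theorem sum_shift_eq_of_invariant (γ : G → ℝ) (δ : G) (N : Finset G) (hN : ∀ z ∈ N, z - δ ∈ N) :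
    ∑ z ∈ N, γ (z - δ) = ∑ z ∈ N, γ z := by
  classical
  refine Finset.sum_nbij (fun z => z - δ) hN ?_ ?_ (fun z _ => rfl)
  · intro z _ z' _ h
    simpa using h
  · intro z' hz'
    obtain ⟨z, hz, h⟩ := Finset.surj_on_of_inj_on_of_card_le (fun z _ => z - δ) (fun z hz => hN z hz)
      (fun _ _ _ _ h => by simpa using h) le_rfl z' (Finset.mem_coe.1 hz')
    exact ⟨z, Finset.mem_coe.2 hz, h.symm⟩

/-- **A letter with a shift-invariant partner set beats the shifted letter**: if `(y, z)` strictly beats `(y + δ, z − δ)` for every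
`z` in a nonempty `δ`-invariant set `N`, then `β(y + δ) < β y`. [folklore] -/
theorem lt_of_invariant_partners (β γ : G → ℝ) (y δ : G) (N : Finset G) (hne : N.Nonempty)
    (hN : ∀ z ∈ N, z - δ ∈ N) (h : ∀ z ∈ N, β (y + δ) + γ (z - δ) < β y + γ z) : β (y + δ) < β y := by
  have h1 := card_mul_sub_lt_of_partners β γ y δ N hne h
  rw [sum_shift_eq_of_invariant γ δ N hN, sub_self] at h1
  have hpos : (0 : ℝ) < N.card := by exact_mod_cast Finset.card_pos.2 hne
  by_contra hle
  push Not at hle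
  have : (0 : ℝ) ≤ (N.card : ℝ) * (β (y + δ) - β y) := mul_nonneg hpos.le (by linarith)
  linarith

/-- Weak version: `β(y + δ) ≤ β y` from weak wins on a nonempty `δ`-invariant partner set. [folklore] -/
theorem le_of_invariant_partners (β γ : G → ℝ) (y δ : G) (N : Finset G) (hne : N.Nonempty)
    (hN : ∀ z ∈ N, z - δ ∈ N) (h : ∀ z ∈ N, β (y + δ) + γ (z - δ) ≤ β y + γ z) : β (y + δ) ≤ β y := by
  have h1 := card_mul_sub_le_of_partners β γ y δ N h
  rw [sum_shift_eq_of_invariant γ δ N hN, sub_self] at h1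
  have hpos : (0 : ℝ) < N.card := by exact_mod_cast Finset.card_pos.2 hne
  by_contra hlt
  push Not at hlt
  have : (0 : ℝ) < (N.card : ℝ) * (β (y + δ) - β y) := mul_pos hpos (by linarith)
  linarith

/-- A coset `{z : z − z₀ ∈ H}` of a subgroup `H` is invariant under every shift `δ ∈ H`. [folklore] -/
theorem coset_shift_mem (H : AddSubgroup G) (z₀ δ z : G) (hδ : δ ∈ H) (hz : z - z₀ ∈ H) : z - δ - z₀ ∈ H := by
  have : z - δ - z₀ = (z - z₀) - δ := by abel
  rw [this]
  exact H.sub_mem hz hδ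

/-- **Coset partners ⇒ strict top of the sub-alphabet.**  At a weight `w`, if `b y + c z` is the strict top of its `Q`-fibre for
every `z` in a (nonempty, finite) coset `{z : z − z₀ ∈ H}` of a subgroup `H`, then `b y` is the strict top of the finite
sub-alphabet `{b (y + h) : h ∈ H}` whenever these points are distinct from `b y` (`⟨w, b(y + δ)⟩ < ⟨w, b y⟩` for `δ ∈ H`, `δ ≠ 0`).
[folklore] -/
theorem dot_lt_of_coset_partners [Fintype G] [DecidableEq G] (b c : G → (Fin 2 → ℝ)) (w : Fin 2 → ℝ) (H : AddSubgroup G)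
    [DecidablePred (· ∈ H)] (y z₀ : G)
    (htop : ∀ z, z - z₀ ∈ H → ∀ y' z', y' + z' = y + z → (y', z') ≠ (y, z) → w ⬝ᵥ (b y' + c z') < w ⬝ᵥ (b y + c z))
    (δ : G) (hδ : δ ∈ H) (hδ0 : δ ≠ 0) : w ⬝ᵥ b (y + δ) < w ⬝ᵥ b y := by
  classical
  set N := Finset.univ.filter fun z : G => z - z₀ ∈ H with hN_def
  have hne : N.Nonempty := ⟨z₀, Finset.mem_filter.2 ⟨Finset.mem_univ _, by simp [H.zero_mem]⟩⟩
  have hN : ∀ z ∈ N, z - δ ∈ N := fun z hz =>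
    Finset.mem_filter.2 ⟨Finset.mem_univ _, coset_shift_mem H z₀ δ z hδ (Finset.mem_filter.1 hz).2⟩
  refine lt_of_invariant_partners (fun y' => w ⬝ᵥ b y') (fun z' => w ⬝ᵥ c z') y δ N hne hN fun z hz => ?_
  have hz : z - z₀ ∈ H := (Finset.mem_filter.1 hz).2
  have hsum : y + δ + (z - δ) = y + z := by abel
  have hneq : (y + δ, z - δ) ≠ (y, z) := by
    intro h
    have := (Prod.mk.inj h).1
    exact hδ0 (by simpa using this)
  have := htop z hz (y + δ) (z - δ) hsum hneq
  simp only [dotProduct_add] at this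
  linarith

/-- The packaged form: under the hypotheses of `dot_lt_of_coset_partners`, `b y` is the strict `w`-top
(`KPTT.PlanarMinkowski.IsStrictTop`) of the finite sub-alphabet `{b (y + h) : h ∈ H}`. [folklore] -/
theorem isStrictTop_subalphabet_of_coset_partners [Fintype G] [DecidableEq G] (b c : G → (Fin 2 → ℝ)) (w : Fin 2 → ℝ)
    (H : AddSubgroup G) [DecidablePred (· ∈ H)] (y z₀ : G)
    (htop : ∀ z, z - z₀ ∈ H → ∀ y' z', y' + z' = y + z → (y', z') ≠ (y, z) → w ⬝ᵥ (b y' + c z') < w ⬝ᵥ (b y + c z)) :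
    IsStrictTop w ((Finset.univ.filter fun h : G => h ∈ H).image fun h => b (y + h)) (b y) := by
  classical
  refine ⟨Finset.mem_image.2 ⟨0, Finset.mem_filter.2 ⟨Finset.mem_univ _, H.zero_mem⟩, by simp⟩, fun p hp hne => ?_⟩
  obtain ⟨δ, hδ, rfl⟩ := Finset.mem_image.1 hp
  have hδH : δ ∈ H := (Finset.mem_filter.1 hδ).2
  have hδ0 : δ ≠ 0 := by rintro rfl; exact hne (by simp)
  exact dot_lt_of_coset_partners b c w H y z₀ htop δ hδH hδ0

/-! ### Nearly invariant partner sets -/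

/-- `Σ_{z∈N} γ(z − δ)` is the sum of `γ` over the shifted set `N − δ`. [folklore] -/
theorem sum_shift_eq_sum_image [DecidableEq G] (γ : G → ℝ) (δ : G) (N : Finset G) :
    ∑ z ∈ N, γ (z - δ) = ∑ z ∈ N.image (fun z => z - δ), γ z := by
  rw [Finset.sum_image fun z _ z' _ h => by simpa using h]

/-- **Nearly invariant partner sets**: if `m ≤ γ ≤ M` then `Σ_{z∈N} γ z − Σ_{z∈N} γ(z − δ) ≤ #(N ∖ (N − δ)) · (M − m)` (the two
sums differ only on the symmetric difference of `N` and `N − δ`, whose halves have equal size). [folklore] -/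
theorem sum_sub_shift_le [DecidableEq G] (γ : G → ℝ) (δ : G) (N : Finset G) (m M : ℝ) (hγ : ∀ z, m ≤ γ z ∧ γ z ≤ M) :
    ∑ z ∈ N, γ z - ∑ z ∈ N, γ (z - δ) ≤ ((N \ N.image fun z => z - δ).card : ℝ) * (M - m) := by
  set Nδ := N.image fun z => z - δ with hNδ
  have hcardNδ : Nδ.card = N.card := Finset.card_image_of_injective _ fun z z' h => by simpa using h
  have hcard : (Nδ \ N).card = (N \ Nδ).card := by
    have h1 := Finset.card_sdiff_add_card_inter Nδ N
    have h2 := Finset.card_sdiff_add_card_inter N Nδ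
    rw [Finset.inter_comm] at h1
    omega
  rw [sum_shift_eq_sum_image, ← Finset.sum_sdiff_sub_sum_sdiff]
  calc ∑ z ∈ N \ Nδ, γ z - ∑ z ∈ Nδ \ N, γ z ≤ ∑ _z ∈ N \ Nδ, M - ∑ _z ∈ Nδ \ N, m :=
        sub_le_sub (Finset.sum_le_sum fun z _ => (hγ z).2) (Finset.sum_le_sum fun z _ => (hγ z).1)
    _ = ((N \ Nδ).card : ℝ) * (M - m) := by
        rw [Finset.sum_const, Finset.sum_const, nsmul_eq_mul, nsmul_eq_mul, hcard]; ring

/-- **Quantitative exchange**: `#N · (β(y+δ) − β y) ≤ #(N ∖ (N−δ)) · (M − m)` — a letter whose partner set is nearly `δ`-invariant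
(small `N ∖ (N − δ)`) nearly beats `y + δ`. [folklore] -/
theorem card_mul_sub_le_card_sdiff_mul [DecidableEq G] (β γ : G → ℝ) (y δ : G) (N : Finset G) (m M : ℝ)
    (hγ : ∀ z, m ≤ γ z ∧ γ z ≤ M) (h : ∀ z ∈ N, β (y + δ) + γ (z - δ) ≤ β y + γ z) :
    (N.card : ℝ) * (β (y + δ) - β y) ≤ ((N \ N.image fun z => z - δ).card : ℝ) * (M - m) :=
  (card_mul_sub_le_of_partners β γ y δ N h).trans (sum_sub_shift_le γ δ N m M hγ)

end TotalsLaw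

end Summit.ValiantsHypothesis.ValiantsHypothesis.Theorems.NewtonUnitEquationsDissociatedUniform
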